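import Mathlib
import Literature.MathematicalPhysics.QuantumFieldTheory.Balaban1983to89.T4TriangularPushforward

/-!
# Reverse absolute continuity of product laws under maps with private TRANSLATION coordinates (abstract measure theory)

Toolkit for the stub `stub_unitDensityPosAE` (STUB D) of crux `SpecificationLimitAE` (stmt-QuantumFields-22688, route
`SpecificationCompactness`, LINE 15 «cocycle_limit» of planner ym-idea-5 g10): a.e.-POSITIVITY of Bałaban's renormalised unit
density is the REVERSE absolute continuity `dV ≪ (avg)_*(ρ dU)` of his block-averaging push-forward (the tree has the forward
direction `HaarAC`, `T4TriangularPushforward` + `BlockAveraging(EML)HaarAC`).  This file is the abstract half, Mathlib only.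

SETTING.  Finite index types `ι` (fine bonds), `κ` (coarse bonds); a measurable group `G` with a probability measure `μ` that is
left- and right-invariant (Haar on a compact group); two injections `β, ℓ : κ → ι` (the PRIVATE coordinate `β c` of the output
`c` — Bałaban's central crossing bond — and a second private coordinate `ℓ c` — one fine bond of ONE chosen off-central loop at
`c`); measurable maps `A, V : (ι → G) → (κ → G)` (`A` = the axial averages `U(c)`, `V` = the chosen open-loop holonomies) which,
after RESAMPLING both private families (`U ↦ extend ℓ u (extend β g U)`), are two-sided translates of the fresh coordinates:
`A = a(U)·g·b(U)`, `V = p(U)·u·s(U)` (hypotheses `hA`, `hV`; no measurability of the coefficients is needed).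

* `map_pair_eq_prod` — THE JOINT LAW of `(A U, (V U c · (A U c)⁻¹)_c)` under `μ^ι` is `μ^κ ⊗ μ^κ`: resampling preserves `μ^ι`
  (tree `T4TriangularPushforward.measurePreserving_resample`, twice), the resampled pair is fibrewise the skew product of two
  coordinatewise two-sided translations (`MeasurePreserving.skew_product`, `measurePreserving_pi`, invariance of `μ`), and the
  second marginal of a product probability law is the factor.
* `pi_le_smul_map_of_eq_on` — if a measurable `T` agrees with `A` wherever every `V U c · (A U c)⁻¹` lies in a measurable set
  `R` (the complement of the small-field guard), then `μ^κ ≤ (μ R ^ |κ|)⁻¹ • (μ^ι).map T`; hence (`R` of positive measure)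
  `pi_absolutelyContinuous_map` : `μ^κ ≪ (μ^ι).map T` and `pi_absolutelyContinuous_map_withDensity` : `μ^κ ≪ ((μ^ι).withDensity ρ).map T`
  for every `ρ ≠ 0` a.e. — the reverse direction of `HaarAC`, with densities.

Everything is [folklore]; nothing about Yang–Mills is asserted here.  Width seat ym-line-sfw-p2-w2 g21 (cell ym-idea-1, free hands).
-/

set_option autoImplicit false

noncomputable section

open MeasureTheory Function Set
open Literature.MathematicalPhysics.QuantumFieldTheory.Balaban1983to89.T4TriangularPushforward
  (measurePreserving_resample)

namespace Summit.QuantumFields.YangMills.Theorems.ReversePushforward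

variable {ι κ G : Type*} [Fintype ι] [Fintype κ] [MeasurableSpace G] [Group G] [MeasurableMul₂ G]
  [MeasurableInv G] (μ : Measure G) [IsProbabilityMeasure μ] [μ.IsMulLeftInvariant] [μ.IsMulRightInvariant]

/-! ## §1 Translations preserve the (product) Haar law -/

omit [MeasurableInv G] [IsProbabilityMeasure μ] in
/-- Two-sided translation `x ↦ a x b` preserves a left- and right-invariant measure. [folklore] -/
theorem measurePreserving_mul_mul (a b : G) : MeasurePreserving (fun x => a * x * b) μ μ :=
  (measurePreserving_mul_right μ b).comp (measurePreserving_mul_left μ a)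

omit [MeasurableInv G] in
/-- Coordinatewise two-sided translation preserves the product law. [folklore] -/
theorem measurePreserving_pi_mul_mul (a b : κ → G) :
    MeasurePreserving (fun (g : κ → G) c => a c * g c * b c) (Measure.pi fun _ : κ => μ) (Measure.pi fun _ : κ => μ) :=
  measurePreserving_pi (fun _ : κ => μ) (fun _ : κ => μ) (fun c => measurePreserving_mul_mul μ (a c) (b c))

/-- **The fibre map** `(g, u) ↦ (w, z)`, `w_c = a_c g_c b_c`, `z_c = p_c u_c (s_c w_c⁻¹)`, preserves `μ^κ ⊗ μ^κ` (a skew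
product of coordinatewise translations). [folklore] -/
theorem measurePreserving_fibreMap (a b p s : κ → G) :
    MeasurePreserving (fun q : (κ → G) × (κ → G) =>
        ((fun c => a c * q.1 c * b c), (fun c => p c * q.2 c * (s c * (a c * q.1 c * b c)⁻¹))))
      ((Measure.pi fun _ : κ => μ).prod (Measure.pi fun _ : κ => μ))
      ((Measure.pi fun _ : κ => μ).prod (Measure.pi fun _ : κ => μ)) := by
  refine (measurePreserving_pi_mul_mul μ a b).skew_product
    (g := fun (g : κ → G) (u : κ → G) => fun c => p c * u c * (s c * (a c * g c * b c)⁻¹)) ?_ ?_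
  · refine measurable_pi_lambda _ fun c => ?_
    have h1 : Measurable fun q : (κ → G) × (κ → G) => q.2 c := (measurable_pi_apply c).comp measurable_snd
    have h2 : Measurable fun q : (κ → G) × (κ → G) => q.1 c := (measurable_pi_apply c).comp measurable_fst
    have h3 : Measurable fun q : (κ → G) × (κ → G) => s c * (a c * q.1 c * b c)⁻¹ :=
      ((h2.const_mul (a c)).mul_const (b c)).inv.const_mul (s c)
    exact (h1.const_mul (p c)).mul h3
  · exact ae_of_all _ fun g => (measurePreserving_pi_mul_mul μ p (fun c => s c * (a c * g c * b c)⁻¹)).map_eq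

/-- Re-association of a triple product law. [folklore] -/
theorem measurePreserving_prodAssoc_symm {α β γ : Type*} [MeasurableSpace α] [MeasurableSpace β] [MeasurableSpace γ]
    (μa : Measure α) (μb : Measure β) (μc : Measure γ) [SFinite μa] [SFinite μb] [SFinite μc] :
    MeasurePreserving (MeasurableEquiv.prodAssoc.symm : α × (β × γ) → (α × β) × γ)
      (μa.prod (μb.prod μc)) ((μa.prod μb).prod μc) :=
  (⟨MeasurableEquiv.prodAssoc.measurable, Measure.prodAssoc_prod⟩ :
    MeasurePreserving (MeasurableEquiv.prodAssoc : (α × β) × γ → α × (β × γ)) ((μa.prod μb).prod μc)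
      (μa.prod (μb.prod μc))).symm _

omit [Group G] [MeasurableMul₂ G] [MeasurableInv G] [μ.IsMulLeftInvariant] [μ.IsMulRightInvariant] in
/-- **Double resampling preserves the product law**: replacing the coordinates `β c` by `g c` and then the coordinates `ℓ c`
by `u c` (`g, u` fresh and independent) leaves `μ^ι` unchanged. [folklore] -/
theorem measurePreserving_resample₂ {β ℓ : κ → ι} (hβ : Injective β) (hℓ : Injective ℓ) :
    MeasurePreserving (fun x : (ι → G) × ((κ → G) × (κ → G)) => extend ℓ x.2.2 (extend β x.2.1 x.1))
      ((Measure.pi fun _ : ι => μ).prod ((Measure.pi fun _ : κ => μ).prod (Measure.pi fun _ : κ => μ)))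
      (Measure.pi fun _ : ι => μ) := by
  have h1 : MeasurePreserving (fun x : ((ι → G) × (κ → G)) × (κ → G) => extend ℓ x.2 (extend β x.1.2 x.1.1))
      (((Measure.pi fun _ : ι => μ).prod (Measure.pi fun _ : κ => μ)).prod (Measure.pi fun _ : κ => μ))
      (Measure.pi fun _ : ι => μ) :=
    (measurePreserving_resample μ hℓ).comp
      ((measurePreserving_resample μ hβ).prod (MeasurePreserving.id (Measure.pi fun _ : κ => μ)))
  exact h1.comp (measurePreserving_prodAssoc_symm _ _ _)

/-! ## §2 The joint law of the axial averages and the chosen loop variables -/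

/-- **THE JOINT LAW.**  If, after resampling the two private families, `A` and `V` are two-sided translates of the fresh
coordinates (`A = a·g·b`, `V = p·u·s` with coefficients depending only on the un-resampled configuration), then under `μ^ι`
the pair `(A U, (V U c · (A U c)⁻¹)_c)` has law `μ^κ ⊗ μ^κ`. [folklore] -/
theorem map_pair_eq_prod {β ℓ : κ → ι} (hβ : Injective β) (hℓ : Injective ℓ)
    (A V : (ι → G) → κ → G) (hAm : Measurable A) (hVm : Measurable V) (a b p s : (ι → G) → κ → G)
    (hA : ∀ (U : ι → G) (g u : κ → G) (c : κ), A (extend ℓ u (extend β g U)) c = a U c * g c * b U c)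
    (hV : ∀ (U : ι → G) (g u : κ → G) (c : κ), V (extend ℓ u (extend β g U)) c = p U c * u c * s U c) :
    (Measure.pi fun _ : ι => μ).map (fun U => (A U, fun c => V U c * (A U c)⁻¹)) =
      (Measure.pi fun _ : κ => μ).prod (Measure.pi fun _ : κ => μ) := by
  classical
  set P : Measure (ι → G) := Measure.pi fun _ : ι => μ with hP
  set ν : Measure (κ → G) := Measure.pi fun _ : κ => μ with hν
  set Ψ : (ι → G) → (κ → G) × (κ → G) := fun U => (A U, fun c => V U c * (A U c)⁻¹) with hΨ
  have hΨm : Measurable Ψ :=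
    hAm.prodMk (measurable_pi_lambda _ fun c =>
      ((measurable_pi_apply c).comp hVm).mul ((measurable_pi_apply c).comp hAm).inv)
  set R2 : (ι → G) × ((κ → G) × (κ → G)) → (ι → G) := fun x => extend ℓ x.2.2 (extend β x.2.1 x.1) with hR2def
  have hR2 : MeasurePreserving R2 (P.prod (ν.prod ν)) P := measurePreserving_resample₂ μ hβ hℓ
  set F : (ι → G) → ((κ → G) × (κ → G)) → ((κ → G) × (κ → G)) := fun U q =>
    ((fun c => a U c * q.1 c * b U c), (fun c => p U c * q.2 c * (s U c * (a U c * q.1 c * b U c)⁻¹))) with hF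
  have hΨR2 : ∀ x, Ψ (R2 x) = F x.1 x.2 := by
    intro x
    refine Prod.ext ?_ ?_
    · funext c
      exact hA x.1 x.2.1 x.2.2 c
    · funext c
      show V (R2 x) c * (A (R2 x) c)⁻¹ = p x.1 c * x.2.2 c * (s x.1 c * (a x.1 c * x.2.1 c * b x.1 c)⁻¹)
      rw [hR2def, hA x.1 x.2.1 x.2.2 c, hV x.1 x.2.1 x.2.2 c, mul_assoc]
  have hFm : Measurable (uncurry F) := by
    have : uncurry F = Ψ ∘ R2 := funext fun x => (hΨR2 x).symm
    rw [this]
    exact hΨm.comp hR2.measurable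
  have hΘ : MeasurePreserving (fun x : (ι → G) × ((κ → G) × (κ → G)) => (x.1, F x.1 x.2))
      (P.prod (ν.prod ν)) (P.prod (ν.prod ν)) :=
    (MeasurePreserving.id P).skew_product hFm
      (ae_of_all _ fun U => (measurePreserving_fibreMap μ (a U) (b U) (p U) (s U)).map_eq)
  calc P.map Ψ = (P.prod (ν.prod ν)).map (Ψ ∘ R2) := by rw [← Measure.map_map hΨm hR2.measurable, hR2.map_eq]
    _ = (P.prod (ν.prod ν)).map (Prod.snd ∘ fun x => (x.1, F x.1 x.2)) := by
        congr 1
        funext x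
        exact hΨR2 x
    _ = ((P.prod (ν.prod ν)).map (fun x => (x.1, F x.1 x.2))).map Prod.snd := by
        rw [Measure.map_map measurable_snd hΘ.measurable]
    _ = (P.prod (ν.prod ν)).map Prod.snd := by rw [hΘ.map_eq]
    _ = ν.prod ν := by rw [Measure.map_snd_prod, measure_univ, one_smul]

/-! ## §3 Reverse absolute continuity from agreement off the guard -/

/-- **REVERSE DOMINATION.**  In the setting of `map_pair_eq_prod`, if a measurable `T` coincides with `A` at every configuration
all of whose chosen loop variables `V U c · (A U c)⁻¹` lie in a measurable set `R`, then
`μ^κ ≤ (μ R ^ |κ|)⁻¹ • (μ^ι).map T`. [folklore] -/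
theorem pi_le_smul_map_of_eq_on {β ℓ : κ → ι} (hβ : Injective β) (hℓ : Injective ℓ)
    (A V : (ι → G) → κ → G) (hAm : Measurable A) (hVm : Measurable V) (a b p s : (ι → G) → κ → G)
    (hA : ∀ (U : ι → G) (g u : κ → G) (c : κ), A (extend ℓ u (extend β g U)) c = a U c * g c * b U c)
    (hV : ∀ (U : ι → G) (g u : κ → G) (c : κ), V (extend ℓ u (extend β g U)) c = p U c * u c * s U c)
    (T : (ι → G) → κ → G) (hTm : Measurable T) {R : Set G} (hR : MeasurableSet R) (hR0 : μ R ≠ 0)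
    (hT : ∀ U, (∀ c, V U c * (A U c)⁻¹ ∈ R) → T U = A U) :
    (Measure.pi fun _ : κ => μ) ≤ (μ R ^ Fintype.card κ)⁻¹ • (Measure.pi fun _ : ι => μ).map T := by
  classical
  have hjoint := map_pair_eq_prod μ hβ hℓ A V hAm hVm a b p s hA hV
  have hΨm : Measurable (fun U => (A U, fun c => V U c * (A U c)⁻¹)) :=
    hAm.prodMk (measurable_pi_lambda _ fun c =>
      ((measurable_pi_apply c).comp hVm).mul ((measurable_pi_apply c).comp hAm).inv)
  have hRpi : MeasurableSet (Set.univ.pi fun _ : κ => R) := MeasurableSet.univ_pi fun _ => hR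
  have hm : (Measure.pi fun _ : κ => μ) (Set.univ.pi fun _ : κ => R) = μ R ^ Fintype.card κ := by
    rw [Measure.pi_pi, Finset.prod_const, Finset.card_univ]
  have hmtop : μ R ^ Fintype.card κ ≠ ⊤ := ENNReal.pow_ne_top (measure_ne_top μ R)
  have hm0 : μ R ^ Fintype.card κ ≠ 0 := pow_ne_zero _ hR0
  rw [Measure.le_iff]
  intro B hB
  rw [Measure.smul_apply, Measure.map_apply hTm hB, smul_eq_mul]
  -- `ν B · μ R ^ |κ| = μ^ι {A ∈ B, all loop variables in R} ≤ μ^ι (T⁻¹ B)`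
  have h1 : (Measure.pi fun _ : κ => μ) B * μ R ^ Fintype.card κ =
      (Measure.pi fun _ : ι => μ) ((fun U => (A U, fun c => V U c * (A U c)⁻¹)) ⁻¹' (B ×ˢ Set.univ.pi fun _ : κ => R)) := by
    rw [← Measure.map_apply hΨm (hB.prod hRpi), hjoint, Measure.prod_prod, hm]
  have h2 : (fun U => (A U, fun c => V U c * (A U c)⁻¹)) ⁻¹' (B ×ˢ Set.univ.pi fun _ : κ => R) ⊆ T ⁻¹' B := by
    intro U hU
    simp only [Set.mem_preimage, Set.mem_prod, Set.mem_univ_pi] at hU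
    show T U ∈ B
    rw [hT U hU.2]
    exact hU.1
  have h3 : (Measure.pi fun _ : κ => μ) B * μ R ^ Fintype.card κ ≤ (Measure.pi fun _ : ι => μ) (T ⁻¹' B) := by
    rw [h1]; exact measure_mono h2
  calc (Measure.pi fun _ : κ => μ) B
      = (Measure.pi fun _ : κ => μ) B * μ R ^ Fintype.card κ / μ R ^ Fintype.card κ := by
        rw [mul_div_assoc, ENNReal.div_self hm0 hmtop, mul_one]
    _ ≤ (Measure.pi fun _ : ι => μ) (T ⁻¹' B) / μ R ^ Fintype.card κ := by gcongr
    _ = (μ R ^ Fintype.card κ)⁻¹ * (Measure.pi fun _ : ι => μ) (T ⁻¹' B) := by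
        rw [div_eq_mul_inv, mul_comm]

/-- **REVERSE ABSOLUTE CONTINUITY** (`μ R > 0`): `μ^κ ≪ (μ^ι).map T`. [folklore] -/
theorem pi_absolutelyContinuous_map {β ℓ : κ → ι} (hβ : Injective β) (hℓ : Injective ℓ)
    (A V : (ι → G) → κ → G) (hAm : Measurable A) (hVm : Measurable V) (a b p s : (ι → G) → κ → G)
    (hA : ∀ (U : ι → G) (g u : κ → G) (c : κ), A (extend ℓ u (extend β g U)) c = a U c * g c * b U c)
    (hV : ∀ (U : ι → G) (g u : κ → G) (c : κ), V (extend ℓ u (extend β g U)) c = p U c * u c * s U c)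
    (T : (ι → G) → κ → G) (hTm : Measurable T) {R : Set G} (hR : MeasurableSet R) (hR0 : μ R ≠ 0)
    (hT : ∀ U, (∀ c, V U c * (A U c)⁻¹ ∈ R) → T U = A U) :
    (Measure.pi fun _ : κ => μ) ≪ (Measure.pi fun _ : ι => μ).map T :=
  Measure.absolutelyContinuous_of_le_smul (pi_le_smul_map_of_eq_on μ hβ hℓ A V hAm hVm a b p s hA hV T hTm hR hR0 hT)

/-- **REVERSE ABSOLUTE CONTINUITY WITH A DENSITY**: for every a.e. non-vanishing density `ρ` on the fine configurations,
`μ^κ ≪ ((μ^ι).withDensity ρ).map T`. [folklore] -/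
theorem pi_absolutelyContinuous_map_withDensity {β ℓ : κ → ι} (hβ : Injective β) (hℓ : Injective ℓ)
    (A V : (ι → G) → κ → G) (hAm : Measurable A) (hVm : Measurable V) (a b p s : (ι → G) → κ → G)
    (hA : ∀ (U : ι → G) (g u : κ → G) (c : κ), A (extend ℓ u (extend β g U)) c = a U c * g c * b U c)
    (hV : ∀ (U : ι → G) (g u : κ → G) (c : κ), V (extend ℓ u (extend β g U)) c = p U c * u c * s U c)
    (T : (ι → G) → κ → G) (hTm : Measurable T) {R : Set G} (hR : MeasurableSet R) (hR0 : μ R ≠ 0)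
    (hT : ∀ U, (∀ c, V U c * (A U c)⁻¹ ∈ R) → T U = A U)
    {ρ : (ι → G) → ENNReal} (hρ : AEMeasurable ρ (Measure.pi fun _ : ι => μ))
    (hρ0 : ∀ᵐ U ∂(Measure.pi fun _ : ι => μ), ρ U ≠ 0) :
    (Measure.pi fun _ : κ => μ) ≪ ((Measure.pi fun _ : ι => μ).withDensity ρ).map T :=
  (pi_absolutelyContinuous_map μ hβ hℓ A V hAm hVm a b p s hA hV T hTm hR hR0 hT).trans
    ((withDensity_absolutelyContinuous' hρ hρ0).map hTm)

end Summit.QuantumFields.YangMills.Theorems.ReversePushforward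

end
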